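import Summits.AtomisticToContinuum.HydrodynamicLimit.Theorems.OneFlightGossipEngineClampedCurrentsDockHeartTools
import Summits.AtomisticToContinuum.HydrodynamicLimit.Theorems.OneFlightGossipEngineClampedCurrentsDockEntropyStep
import HarnessLib

/-!
# The heart of Yau's entropy ledger — the channels in expectation (crux `ClampedCurrentsDock`, stmt-14680, line `IdeatorTwoSketch`)

Helper file (`--supports stmt-AtomisticToContinuum-14680`) for the registered stub `stub_oneWindowLedger`: (i) real-integral bounds
under the true law for nonnegative window functionals carried by the good set (tails, cubic channel, third moments), (ii) the
entropy-inequality step (ES, landed) in the form delivered by the two reference-law inputs — a clamped, centred collisional row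
`(A − c) − X∘Φ_s` with `A` a streaming window functional of quadratic growth and `X` a bounded functional with a measurable version —
and (iii) its kinetic special case. prover-line-stmt-AtomisticToContinuum-14680-c2-0 (lead c2).
-/

noncomputable section

namespace Summit.AtomisticToContinuum.HydrodynamicLimit.Theorems.ClampedCurrentsDockHeart

open scoped BigOperators ENNReal Classical Interval
open MeasureTheory Filter Set Topology InformationTheory
open Literature.MathematicalPhysics.KineticTheory Literature.Analysis.FluidPDE Literature.Analysis.FunctionSpaces
open Summit.AtomisticToContinuum.HydrodynamicLimit.Theorems
open Summit.AtomisticToContinuum.HydrodynamicLimit.Theorems.ClampedCurrentsDockEntropyStep (WindowEntropyStep stub_windowEntropyStep)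

/-! ## §1 Nonnegative functionals carried by the good set -/

/-- **Real-integral bound from a `lintegral` bound under the true law**, for a functional that is nonnegative on the good set and
agrees there with a measurable function. [folklore] -/
theorem integral_le_of_good_version {σ : ℝ} {N : ℕ} (Φ : HardSphereFlow (Torus.geometry (Fin 3)) (hsDiameter σ N) (N + 1))
    (a₀ θ₀ : T3 → ℝ) (u₀ : T3 → V3) {f : Config (N + 1) (Fin 3) T3 → ℝ} {c : ℝ}
    (hver : ∃ Y : Config (N + 1) (Fin 3) T3 → ℝ, Measurable Y ∧ Set.EqOn Y f Φ.good)
    (h0 : ∀ z ∈ Φ.good, 0 ≤ f z) (hc : 0 ≤ c)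
    (h : ∫⁻ z, ENNReal.ofReal (f z) ∂(localGibbsLaw σ a₀ u₀ θ₀ N Φ) ≤ ENNReal.ofReal c) :
    Integrable f (localGibbsLaw σ a₀ u₀ θ₀ N Φ) ∧ ∫ z, f z ∂(localGibbsLaw σ a₀ u₀ θ₀ N Φ) ≤ c := by
  have hgood : ∀ᵐ z ∂(localGibbsLaw σ a₀ u₀ θ₀ N Φ), z ∈ Φ.good := ae_mem_good_localGibbsLaw σ a₀ u₀ θ₀ N Φ
  obtain ⟨Y, hYm, hY⟩ := hver
  have hae : f =ᵐ[localGibbsLaw σ a₀ u₀ θ₀ N Φ] Y := hgood.mono fun z hz => (hY hz).symm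
  have hfm : AEStronglyMeasurable f (localGibbsLaw σ a₀ u₀ θ₀ N Φ) := ⟨Y, hYm.stronglyMeasurable, hae⟩
  exact integrable_and_integral_le_of_lintegral_le hfm (hgood.mono fun z hz => h0 z hz) hc h

/-- The normalised form of a `lintegral` bound: `∫⁻ ofReal((N+1)⁻¹ f) ≤ ofReal ε` gives `∫⁻ ofReal f ≤ ofReal((N+1) ε)` for
`f ≥ 0`. [folklore] -/
theorem lintegral_le_of_normalised {α : Type*} [MeasurableSpace α] {μ : Measure α} {f : α → ℝ} {N : ℕ} {ε : ℝ}
    (h : ∫⁻ x, ENNReal.ofReal (((N : ℝ) + 1)⁻¹ * f x) ∂μ ≤ ENNReal.ofReal ε) :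
    ∫⁻ x, ENNReal.ofReal (f x) ∂μ ≤ ENNReal.ofReal (((N : ℝ) + 1) * ε) := by
  have hN : (0 : ℝ) < (N : ℝ) + 1 := by positivity
  have hpt : ∀ x, ENNReal.ofReal (f x) = ENNReal.ofReal ((N : ℝ) + 1) * ENNReal.ofReal (((N : ℝ) + 1)⁻¹ * f x) := by
    intro x
    rw [← ENNReal.ofReal_mul hN.le]
    congr 1
    field_simp
  calc ∫⁻ x, ENNReal.ofReal (f x) ∂μ
      = ENNReal.ofReal ((N : ℝ) + 1) * ∫⁻ x, ENNReal.ofReal (((N : ℝ) + 1)⁻¹ * f x) ∂μ := by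
        rw [← lintegral_const_mul' _ _ ENNReal.ofReal_ne_top]
        exact lintegral_congr hpt
    _ ≤ ENNReal.ofReal ((N : ℝ) + 1) * ENNReal.ofReal ε := mul_le_mul_right h _
    _ = ENNReal.ofReal (((N : ℝ) + 1) * ε) := (ENNReal.ofReal_mul hN.le).symm

/-! ## §2 The entropy step in the form of the reference-law inputs -/

/-- **One collisional row in expectation.** Under the true law `λ_N`, the centred clamped row
`(∫_s^{s+w} Σ_i F(Φ_r z)_i dr − c) − X(Φ_s z)` (streaming part `F` continuous of quadratic growth, `X` bounded on the good set with a
measurable version) is integrable with mean at most `w γ⁻¹ (KL(f_s ‖ ψ) + B)` as soon as the reference law `ψ` carries the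
exponential bound in the form delivered by `LocalClampedTransferWindowLDFamily` at tilt `−γ`:
`∫ exp(−γ (w⁻¹ X − w⁻¹(∫₀^w Σ_i F − c))) dψ ≤ e^B` (ES after rewriting the exponent on the good set). [cite: Yau1991, §2] -/
theorem row_expectation {σ : ℝ} {N : ℕ}
    (Φ : HardSphereFlow (Torus.geometry (Fin 3)) (hsDiameter σ N) (N + 1))
    {a₀ θ₀ : T3 → ℝ} {u₀ : T3 → V3} {b ϑ : T3 → ℝ} {wv : T3 → V3} {F : T3 × V3 → ℝ}
    {X : Config (N + 1) (Fin 3) T3 → ℝ} {C Mx γ B s w c : ℝ}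
    (hσ : 0 < σ) (hσ2 : σ < 1 / 2) (ha : Continuous a₀) (hθ : Continuous θ₀) (hu : Continuous u₀)
    (ha0 : ∀ x, 0 < a₀ x) (hθ0 : ∀ x, 0 < θ₀ x) (hb : Continuous b) (hϑ : Continuous ϑ) (hwv : Continuous wv)
    (hb0 : ∀ x, 0 < b x) (hϑ0 : ∀ x, 0 < ϑ x) (hF : Continuous F) (hFC : ∀ y, |F y| ≤ C * (1 + ‖y.2‖ ^ 2))
    (hX : ∃ Y : Config (N + 1) (Fin 3) T3 → ℝ, Measurable Y ∧ Set.EqOn Y X Φ.good)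
    (hXb : ∀ z ∈ Φ.good, |X z| ≤ Mx) (hs : 0 ≤ s) (hw : 0 < w) (hγ : 0 < γ)
    (hbound : ∫⁻ z, ENNReal.ofReal (Real.exp ((-γ) *
        (w⁻¹ * X z - w⁻¹ * ((∫ r in (0 : ℝ)..w, ∑ i : Fin (N + 1), F (Φ.flow r z i)) - c))))
        ∂(localGibbsLaw σ b wv ϑ N Φ) ≤ ENNReal.ofReal (Real.exp B)) :
    Integrable (fun z => ((∫ r in s..(s + w), ∑ i : Fin (N + 1), F (Φ.flow r z i)) - c) - X (Φ.flow s z))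
        (localGibbsLaw σ a₀ u₀ θ₀ N Φ) ∧
      ∫ z, (((∫ r in s..(s + w), ∑ i : Fin (N + 1), F (Φ.flow r z i)) - c) - X (Φ.flow s z))
          ∂(localGibbsLaw σ a₀ u₀ θ₀ N Φ) ≤
        w * (γ⁻¹ * ((klDiv (Φ.lawAt (localGibbsLaw σ a₀ u₀ θ₀ N Φ) s) (localGibbsLaw σ b wv ϑ N Φ)).toReal + B)) := by
  obtain ⟨Y, hYm, hY⟩ := hX
  have hgoodl : ∀ᵐ z ∂(localGibbsLaw σ a₀ u₀ θ₀ N Φ), z ∈ Φ.good := ae_mem_good_localGibbsLaw σ a₀ u₀ θ₀ N Φ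
  have hgoodψ : ∀ᵐ z ∂(localGibbsLaw σ b wv ϑ N Φ), z ∈ Φ.good := ae_mem_good_localGibbsLaw σ b wv ϑ N Φ
  have hw0 : w ≠ 0 := hw.ne'
  -- the collision part and its measurable version
  set Yc : Config (N + 1) (Fin 3) T3 → ℝ := fun z => -w⁻¹ * X z - w⁻¹ * c with hYc
  set Ym : Config (N + 1) (Fin 3) T3 → ℝ := fun z => -w⁻¹ * Y z - w⁻¹ * c with hYm'
  have hYmm : Measurable Ym := (hYm.const_mul _).sub measurable_const
  have hYmc : Set.EqOn Ym Yc Φ.good := fun z hz => by simp only [hYm', hYc, hY hz]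
  have hYcM : ∀ z ∈ Φ.good, |Yc z| ≤ |w⁻¹| * Mx + |w⁻¹ * c| := fun z hz => by
    simp only [hYc]
    calc |-w⁻¹ * X z - w⁻¹ * c| ≤ |-w⁻¹ * X z| + |w⁻¹ * c| := abs_sub _ _
      _ ≤ |w⁻¹| * Mx + |w⁻¹ * c| := by
          rw [abs_mul, abs_neg]
          gcongr
          exact hXb z hz
  -- sum/integral swap on the good set
  have hswap : ∀ z ∈ Φ.good, ∀ a₁ a₂ : ℝ, (∫ r in a₁..a₂, ∑ i : Fin (N + 1), F (Φ.flow r z i)) =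
      ∑ i : Fin (N + 1), ∫ r in a₁..a₂, F (Φ.flow r z i) := fun z hz a₁ a₂ => integral_sum_orbit Φ hz hF a₁ a₂
  -- the exponential bound in ES form
  have hB' : ∫⁻ z, ENNReal.ofReal (Real.exp (γ *
      ((∑ i : Fin (N + 1), w⁻¹ * ∫ r in (0 : ℝ)..w, F (Φ.flow r z i)) + Yc z))) ∂(localGibbsLaw σ b wv ϑ N Φ) ≤
      ENNReal.ofReal (Real.exp B) := by
    refine le_of_eq_of_le (lintegral_congr_ae ?_) hbound
    filter_upwards [hgoodψ] with z hz
    rw [hswap z hz, hYc, ← Finset.mul_sum]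
    congr 2
    ring
  obtain ⟨hint, hle⟩ := stub_windowEntropyStep σ N Φ a₀ θ₀ u₀ b ϑ wv F Yc Ym C (|w⁻¹| * Mx + |w⁻¹ * c|) γ B s w hσ hσ2 ha hθ hu ha0 hθ0
    hb hϑ hwv hb0 hϑ0 hF hFC hYmm hYmc hYcM hs hw hγ hB'
  -- our integrand is `w` times the ES integrand, almost surely
  have hae : (fun z => ((∫ r in s..(s + w), ∑ i : Fin (N + 1), F (Φ.flow r z i)) - c) - X (Φ.flow s z))
      =ᵐ[localGibbsLaw σ a₀ u₀ θ₀ N Φ]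
      fun z => w * ((∑ i : Fin (N + 1), w⁻¹ * ∫ r in s..(s + w), F (Φ.flow r z i)) + Yc (Φ.flow s z)) := by
    filter_upwards [hgoodl] with z hz
    rw [hswap z hz, hYc, ← Finset.mul_sum]
    field_simp
    ring
  refine ⟨(hint.const_mul w).congr hae.symm, ?_⟩
  rw [integral_congr_ae hae, integral_const_mul]
  exact mul_le_mul_of_nonneg_left hle hw.le

/-- **The kinetic channel in expectation**: the special case `X = 0`, `c = 0` with the sign of `KineticCurrentsWindowLDFamily`
(`F ↦ −lo`): `E_λ[−∫_s^{s+w} Σ_i lo(Φ_r z)_i dr] ≤ w γ⁻¹ (KL(f_s ‖ ψ) + B)` when `∫ exp(−γ Σ_i w⁻¹∫₀^w lo) dψ ≤ e^B`.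
[cite: Yau1991, §2] -/
theorem kinetic_expectation {σ : ℝ} {N : ℕ}
    (Φ : HardSphereFlow (Torus.geometry (Fin 3)) (hsDiameter σ N) (N + 1))
    {a₀ θ₀ : T3 → ℝ} {u₀ : T3 → V3} {b ϑ : T3 → ℝ} {wv : T3 → V3} {lo : T3 × V3 → ℝ} {C γ B s w : ℝ}
    (hσ : 0 < σ) (hσ2 : σ < 1 / 2) (ha : Continuous a₀) (hθ : Continuous θ₀) (hu : Continuous u₀)
    (ha0 : ∀ x, 0 < a₀ x) (hθ0 : ∀ x, 0 < θ₀ x) (hb : Continuous b) (hϑ : Continuous ϑ) (hwv : Continuous wv)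
    (hb0 : ∀ x, 0 < b x) (hϑ0 : ∀ x, 0 < ϑ x) (hlo : Continuous lo) (hloC : ∀ y, |lo y| ≤ C * (1 + ‖y.2‖ ^ 2))
    (hs : 0 ≤ s) (hw : 0 < w) (hγ : 0 < γ)
    (hbound : ∫⁻ z, ENNReal.ofReal (Real.exp ((-γ) * ∑ i : Fin (N + 1),
        w⁻¹ * ∫ r in (0 : ℝ)..w, lo (Φ.flow r z i))) ∂(localGibbsLaw σ b wv ϑ N Φ) ≤ ENNReal.ofReal (Real.exp B)) :
    Integrable (fun z => -(∫ r in s..(s + w), ∑ i : Fin (N + 1), lo (Φ.flow r z i))) (localGibbsLaw σ a₀ u₀ θ₀ N Φ) ∧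
      ∫ z, -(∫ r in s..(s + w), ∑ i : Fin (N + 1), lo (Φ.flow r z i)) ∂(localGibbsLaw σ a₀ u₀ θ₀ N Φ) ≤
        w * (γ⁻¹ * ((klDiv (Φ.lawAt (localGibbsLaw σ a₀ u₀ θ₀ N Φ) s) (localGibbsLaw σ b wv ϑ N Φ)).toReal + B)) := by
  have hgoodψ : ∀ᵐ z ∂(localGibbsLaw σ b wv ϑ N Φ), z ∈ Φ.good := ae_mem_good_localGibbsLaw σ b wv ϑ N Φ
  have hF : Continuous fun y => -lo y := hlo.neg
  have hFC : ∀ y : T3 × V3, |(-lo y)| ≤ C * (1 + ‖y.2‖ ^ 2) := fun y => by rw [abs_neg]; exact hloC y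
  have hX : ∃ Y : Config (N + 1) (Fin 3) T3 → ℝ, Measurable Y ∧ Set.EqOn Y (fun _ => (0 : ℝ)) Φ.good :=
    ⟨fun _ => 0, measurable_const, fun _ _ => rfl⟩
  have hXb : ∀ z ∈ Φ.good, |(fun _ : Config (N + 1) (Fin 3) T3 => (0 : ℝ)) z| ≤ 0 := fun z _ => by simp
  have hbound' : ∫⁻ z, ENNReal.ofReal (Real.exp ((-γ) *
      (w⁻¹ * (fun _ : Config (N + 1) (Fin 3) T3 => (0 : ℝ)) z -
        w⁻¹ * ((∫ r in (0 : ℝ)..w, ∑ i : Fin (N + 1), (-lo (Φ.flow r z i))) - 0))))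
        ∂(localGibbsLaw σ b wv ϑ N Φ) ≤ ENNReal.ofReal (Real.exp B) := by
    refine le_of_eq_of_le (lintegral_congr_ae ?_) hbound
    filter_upwards [hgoodψ] with z hz
    rw [integral_sum_orbit Φ hz hF]
    congr 2
    simp only [intervalIntegral.integral_neg, mul_zero, zero_sub, mul_neg, Finset.sum_neg_distrib, neg_mul,
      neg_neg, Finset.mul_sum, sub_zero]
  obtain ⟨hint, hle⟩ := row_expectation Φ hσ hσ2 ha hθ hu ha0 hθ0 hb hϑ hwv hb0 hϑ0 hF hFC hX hXb hs hw hγ hbound'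
  have heq : (fun z => ((∫ r in s..(s + w), ∑ i : Fin (N + 1), (-lo (Φ.flow r z i))) - 0) -
      (fun _ : Config (N + 1) (Fin 3) T3 => (0 : ℝ)) (Φ.flow s z)) =
      fun z => -(∫ r in s..(s + w), ∑ i : Fin (N + 1), lo (Φ.flow r z i)) := by
    funext z
    simp only [sub_zero, Finset.sum_neg_distrib, intervalIntegral.integral_neg]
  rw [heq] at hint hle
  exact ⟨hint, hle⟩

/-! ## §3 The bookkeeping of one window in expectation -/

/-- **One window in expectation (pure bookkeeping).** If the entropy production `−X` of the window is dominated on the good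
set by `kin + hiT + J + K₁·tail + 2C_f w·cub + K_c` with the channel bounds of the heart (kinetic and collisional rows through
the entropy inequality at tilt `β`, cubic channel `w(N+1)ε′/10`, activity tails `(N+1)ε₃`, third moments `w(N+1)(M³+1)`), the
accuracies `ε₁ = βε′/10`, `ε₃ = ε′/(40(L+1))` and the window smallness `C_f w · 40(2M³ + 6 + V) ≤ ε′ ≤ 1`, then
`−E[X] ≤ (5/β) w H + w(N+1)ε′ + w(N+1)Cst`. [cite: Yau1991, §3] -/
theorem window_bookkeeping {Ω : Type*} [MeasurableSpace Ω] {P : Measure Ω} [IsProbabilityMeasure P] {good : Set Ω}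
    (hgood : ∀ᵐ z ∂P, z ∈ good) {X kin hiT J tail cub : Ω → ℝ}
    {w β Hs ε' ε₁ ε₃ L Cf M V Nr Cst : ℝ}
    (hw : 0 < w) (hβ : 0 < β) (hε : 0 < ε') (hε1 : ε' ≤ 1) (hL : 0 ≤ L) (hCf : 0 ≤ Cf) (hM : 0 ≤ M) (hV : 0 ≤ V)
    (hNr : 0 < Nr) (hε₁ : ε₁ = β * ε' / 10) (hε₃ : ε₃ = ε' / (40 * (L + 1)))
    (hsmall : Cf * w * (40 * (2 * M ^ 3 + 6 + V)) ≤ ε')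
    (hX : Integrable X P)
    (hdom : ∀ z ∈ good, -X z ≤ kin z + hiT z + J z + (2 * L * w + 2 * Cf * w ^ 2) * tail z + (2 * Cf * w) * cub z +
      (w * Nr * Cst + 3 * Cf * w ^ 2 * Nr + 2 * Cf * w ^ 2 * (Nr * V)))
    (hkin : Integrable kin P ∧ ∫ z, kin z ∂P ≤ w * (β⁻¹ * (Hs + ε₁ * Nr)))
    (hhiT : Integrable hiT P ∧ ∫ z, hiT z ∂P ≤ w * Nr * (ε' / 10))
    (hJ : Integrable J P ∧ ∫ z, J z ∂P ≤ 4 * (w * (β⁻¹ * (Hs + ε₁ / 4 * Nr))))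
    (htail : Integrable tail P ∧ ∫ z, tail z ∂P ≤ Nr * ε₃)
    (hcub : Integrable cub P ∧ ∫ z, cub z ∂P ≤ w * Nr * (M ^ 3 + 1)) :
    -(∫ z, X z ∂P) ≤ 5 / β * w * Hs + w * Nr * ε' + w * Nr * Cst := by
  set Kc : ℝ := w * Nr * Cst + 3 * Cf * w ^ 2 * Nr + 2 * Cf * w ^ 2 * (Nr * V) with hKc
  set Gf : Ω → ℝ := fun z => kin z + hiT z + J z + (2 * L * w + 2 * Cf * w ^ 2) * tail z + (2 * Cf * w) * cub z + Kc with hGf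
  have I2 : Integrable (fun z => kin z + hiT z) P := hkin.1.add hhiT.1
  have I3 : Integrable (fun z => kin z + hiT z + J z) P := I2.add hJ.1
  have J4 : Integrable (fun z => (2 * L * w + 2 * Cf * w ^ 2) * tail z) P := htail.1.const_mul _
  have I4 : Integrable (fun z => kin z + hiT z + J z + (2 * L * w + 2 * Cf * w ^ 2) * tail z) P := I3.add J4
  have J5 : Integrable (fun z => (2 * Cf * w) * cub z) P := hcub.1.const_mul _
  have I5 : Integrable (fun z => kin z + hiT z + J z + (2 * L * w + 2 * Cf * w ^ 2) * tail z + (2 * Cf * w) * cub z) P :=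
    I4.add J5
  have hGfI : Integrable Gf P := I5.add (integrable_const _)
  have hGfint : ∫ z, Gf z ∂P = (∫ z, kin z ∂P) + (∫ z, hiT z ∂P) + (∫ z, J z ∂P) +
      (2 * L * w + 2 * Cf * w ^ 2) * (∫ z, tail z ∂P) + (2 * Cf * w) * (∫ z, cub z ∂P) + Kc := by
    simp only [hGf]
    rw [integral_add I5 (integrable_const _), integral_add I4 J5, integral_add I3 J4, integral_add I2 hJ.1,
      integral_add hkin.1 hhiT.1, integral_const_mul, integral_const_mul, integral_const, probReal_univ, one_smul]
  have hmono : ∫ z, -X z ∂P ≤ ∫ z, Gf z ∂P :=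
    integral_mono_ae hX.neg hGfI (hgood.mono fun z hz => by simpa only [hGf, hKc] using hdom z hz)
  rw [integral_neg, hGfint] at hmono
  -- the accuracies
  have hX1 : Cf * w ≤ 1 := by
    have hQ : (40 : ℝ) ≤ 40 * (2 * M ^ 3 + 6 + V) := by nlinarith [pow_nonneg hM 3]
    nlinarith [mul_nonneg hCf hw.le]
  have t1 : w * (β⁻¹ * (Hs + ε₁ * Nr)) + 4 * (w * (β⁻¹ * (Hs + ε₁ / 4 * Nr))) = 5 / β * w * Hs + w * Nr * (ε' / 5) := by
    rw [hε₁]; field_simp; ring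
  have t3 : (2 * L * w + 2 * Cf * w ^ 2) * (Nr * ε₃) ≤ w * Nr * (ε' / 20) := by
    have h : (2 * L + 2 * (Cf * w)) * ε₃ ≤ ε' / 20 := by
      rw [hε₃, mul_div_assoc', div_le_div_iff₀ (by positivity) (by norm_num : (0 : ℝ) < 20)]
      nlinarith [mul_nonneg hCf hw.le, hε.le]
    have e : (2 * L * w + 2 * Cf * w ^ 2) * (Nr * ε₃) = w * Nr * ((2 * L + 2 * (Cf * w)) * ε₃) := by ring
    rw [e]
    exact mul_le_mul_of_nonneg_left h (by positivity)
  have t4 : (2 * Cf * w) * (w * Nr * (M ^ 3 + 1)) + (3 * Cf * w ^ 2 * Nr + 2 * Cf * w ^ 2 * (Nr * V)) ≤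
      w * Nr * (ε' / 20) := by
    have h : Cf * w * (2 * (M ^ 3 + 1) + 3 + 2 * V) ≤ ε' / 20 := by
      have : 2 * (M ^ 3 + 1) + 3 + 2 * V ≤ 2 * (2 * M ^ 3 + 6 + V) := by nlinarith [pow_nonneg hM 3]
      nlinarith [mul_nonneg hCf hw.le]
    have e : (2 * Cf * w) * (w * Nr * (M ^ 3 + 1)) + (3 * Cf * w ^ 2 * Nr + 2 * Cf * w ^ 2 * (Nr * V)) =
        w * Nr * (Cf * w * (2 * (M ^ 3 + 1) + 3 + 2 * V)) := by ring
    rw [e]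
    exact mul_le_mul_of_nonneg_left h (by positivity)
  have hwN : 0 ≤ w * Nr * ε' := by positivity
  have m4 := mul_le_mul_of_nonneg_left htail.2 (by positivity : (0 : ℝ) ≤ 2 * L * w + 2 * Cf * w ^ 2)
  have m5 := mul_le_mul_of_nonneg_left hcub.2 (by positivity : (0 : ℝ) ≤ 2 * Cf * w)
  simp only [hKc] at hmono
  linarith [hmono, hkin.2, hhiT.2, hJ.2, m4, m5, t1, t3, t4, hwN]

end Summit.AtomisticToContinuum.HydrodynamicLimit.Theorems.ClampedCurrentsDockHeart

end
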